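import Summits.Ventures.YMGap.Conjectures.ChiralClockComparison
import Summits.Ventures.YMGap.Conjectures.ChiralClockTransmission
import Mathlib.Analysis.SpecialFunctions.Complex.Arg
import HarnessLib

/-!
# Venture YMGap — Conjectures/ChiralClockComparisonSingleEdge.lean: what is PROVED of the typed conjecture (C)
# `ChiralClockComparison` — (C) itself on `n ≤ 2` vertices (one chiral edge, both orientations, any diagonal entries)

HONEST FRAMING (venture `Summits/Ventures/YMGap`, cell `pub-ymgap`, track Y2 ROBUST-BALL, seat ds-4 g14).  Theorems plus ONE auxiliary
definition (`edgeProfile`); the conjecture `ChiralClockComparison` (file `Conjectures/ChiralClockComparison.lean`, the one open point of the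
centre-blind `β`-ladder for odd `N`) is NOT proved here for general graphs and keeps its status (conjecture with pre-registered numerical
support, rounds 1–2).  This file records the base case every proof strategy needs, on top of the single-edge transmission lemma (C1) of
`Conjectures/ChiralClockTransmission.lean`:

* `omegaPow_zero/one/two`: `ω⁰ = 1`, `ω = −1/2 + i√3/2`, `ω² = −1/2 − i√3/2`; `norm_sq_fourier_three`:
  `‖x₀ + x₁ω + x₂ω²‖² = Σx_k² − Σ_{i<j}x_ix_j` for real `x`;
* **`transmission_le`** (model-free (C1)): for real `P, Q`, `A = |P + iQ|`, the weights `x_d = e^{P cos θ_d − Q sin θ_d}` (`θ_d = 2πd/3`;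
  `= e^{A cos(θ_d + arg(P+iQ))}`, polar form via `Complex.arg`) satisfy `‖x₀ + x₁ω + x₂ω²‖·(e^A + 2e^{−A/2}) ≤ (e^A − e^{−A/2})·(x₀ + x₁ + x₂)`;
* `sum_fin_two_sub`, `chiralClockWeight_two`, `sum_weight_two`: on `Fin 2` the weight of `Conjectures/ChiralClockComparison.lean` factorises
  through `d = k₀ − k₁` (the two oriented entries `a 0 1 e^{iφ₀₁}`, `a 1 0 e^{−iφ₁₀}` merge into ONE chiral edge of coupling
  `A = |a₀₁e^{iφ₀₁} + a₁₀e^{−iφ₁₀}| ≤ a₀₁ + a₁₀`, `edgeProfile_one/two`) and the nine-term sums collapse to three-term sums;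
* **`chiralClockComparison_two`, `chiralClockComparison_of_le_two`**: the typed conjecture restricted to `n ≤ 2` vertices is a THEOREM —
  `‖⟨ω^{k_b−k_t}⟩_{a,φ}‖ ≤ Re ⟨ω^{k_b−k_t}⟩_{a,0}` for all `a ≥ 0`, `φ`, `b, t : Fin n`, `n ≤ 2` ((C1) + `transmission_mono` with `A ≤ a₀₁ + a₁₀`;
  the diagonal two-point function is `1`, `chiralClockCorr_self`, any `n`).
What remains OPEN is exactly the many-vertex statement (a path of length `≥ 2` or a cycle): by SUBCRITICAL-LAYER §8h the slack of (C1) is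
NEEDED there (the equal-modulus variant (C2) is false on `K₄`), so no proof can bypass (C1).  Evidence for the open part: pre-registered
rounds 1 (14/14, kit j229411) and 2 (sealed `HOME/ds/ds4/oddN/PREREG-C-round2.md`, kit j231321, incl. the LOCAL second-order form).  Nothing here
is about gauge fields, limits or the Clay problem.  Reference: G. Mack, V. B. Petkova, Ann. Phys. 123 (1979) 442 [cite: MackPetkova1979, §2].
-/

noncomputable section

open Real
open Literature.Probability.LatticeModels.DiluteA22 (cos_two_pi_div_three sin_two_pi_div_three)

namespace Summit.Ventures.YMGap.Conjectures

/-! ### The cube roots of unity `omegaPow` -/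

/-- `ω⁰ = 1`. [folklore] -/
theorem omegaPow_zero : omegaPow 0 = 1 := by
  simp [omegaPow]

/-- `ω = e^{2πi/3} = −1/2 + i√3/2`. [folklore] -/
theorem omegaPow_one : omegaPow 1 = ⟨-1 / 2, √3 / 2⟩ := by
  have hv : ((1 : ZMod 3).val : ℂ) = 1 := by
    have : (1 : ZMod 3).val = 1 := by decide
    rw [this, Nat.cast_one]
  have harg : 2 * (Real.pi : ℂ) * Complex.I * ((1 : ZMod 3).val : ℂ) / 3 = ((2 * π / 3 : ℝ) : ℂ) * Complex.I := by
    rw [hv]; push_cast; ring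
  unfold omegaPow
  rw [harg]
  apply Complex.ext
  · rw [Complex.exp_ofReal_mul_I_re, cos_two_pi_div_three]
  · rw [Complex.exp_ofReal_mul_I_im, sin_two_pi_div_three]

/-- `ω² = e^{4πi/3} = −1/2 − i√3/2`. [folklore] -/
theorem omegaPow_two : omegaPow 2 = ⟨-1 / 2, -(√3 / 2)⟩ := by
  have hv : ((2 : ZMod 3).val : ℂ) = 2 := by
    have : (2 : ZMod 3).val = 2 := by decide
    rw [this, Nat.cast_ofNat]
  have harg : 2 * (Real.pi : ℂ) * Complex.I * ((2 : ZMod 3).val : ℂ) / 3 = ((4 * π / 3 : ℝ) : ℂ) * Complex.I := by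
    rw [hv]; push_cast; ring
  unfold omegaPow
  rw [harg]
  apply Complex.ext
  · rw [Complex.exp_ofReal_mul_I_re, cos_four_pi_div_three]
  · rw [Complex.exp_ofReal_mul_I_im, sin_four_pi_div_three]

/-- Sums over `ZMod 3`. [folklore] -/
theorem sum_zmod_three {M : Type*} [AddCommMonoid M] (f : ZMod 3 → M) : ∑ d, f d = f 0 + f 1 + f 2 :=
  Fin.sum_univ_three f

/-- **The first Fourier coefficient of three real weights**: `x₀ + x₁ω + x₂ω² = (x₀ − (x₁+x₂)/2) + i(√3/2)(x₁ − x₂)` and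
`‖x₀ + x₁ω + x₂ω²‖² = x₀² + x₁² + x₂² − x₀x₁ − x₀x₂ − x₁x₂`. [folklore] -/
theorem norm_sq_fourier_three (x0 x1 x2 : ℝ) :
    ‖(x0 : ℂ) * omegaPow 0 + (x1 : ℂ) * omegaPow 1 + (x2 : ℂ) * omegaPow 2‖ ^ 2 =
      x0 ^ 2 + x1 ^ 2 + x2 ^ 2 - x0 * x1 - x0 * x2 - x1 * x2 := by
  have hN : (x0 : ℂ) * omegaPow 0 + (x1 : ℂ) * omegaPow 1 + (x2 : ℂ) * omegaPow 2 =
      ⟨x0 - (x1 + x2) / 2, √3 / 2 * (x1 - x2)⟩ := by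
    rw [omegaPow_zero, omegaPow_one, omegaPow_two]
    apply Complex.ext <;> simp <;> ring
  rw [hN, Complex.sq_norm, Complex.normSq_apply]
  have h33 : √3 * √3 = 3 := Real.mul_self_sqrt (by norm_num)
  simp only
  linear_combination ((x1 - x2) ^ 2 / 4) * h33

/-! ### The single edge: polar form of a general first-harmonic profile and the transmission bound -/

/-- **SINGLE-EDGE TRANSMISSION BOUND (C1), model-free form.**  For real `P, Q` put `A = ‖P + iQ‖ = √(P²+Q²)` and let
`x_d = exp(P cos θ_d − Q sin θ_d)`, `θ_d = 2πd/3` (`d = 0, 1, 2`) — the weights `e^{A cos(θ_d + Φ)}` of a chiral `ℤ₃` edge with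
coupling `A` and phase `Φ = arg(P + iQ)`.  Then `‖x₀ + x₁ω + x₂ω²‖·(e^A + 2e^{−A/2}) ≤ (e^A − e^{−A/2})·(x₀ + x₁ + x₂)`, i.e. the modulus
of the chiral transmission `|ĉ_Φ(1)|/ĉ_Φ(0)` is at most the ferromagnetic one `ĉ_0(1)/ĉ_0(0) = (e^A − e^{−A/2})/(e^A + 2e^{−A/2})` at the
same coupling. [folklore] -/
theorem transmission_le (P Q : ℝ) :
    ‖((exp P : ℝ) : ℂ) * omegaPow 0 + ((exp (P * cos (2 * π / 3) - Q * sin (2 * π / 3)) : ℝ) : ℂ) * omegaPow 1 +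
        ((exp (P * cos (4 * π / 3) - Q * sin (4 * π / 3)) : ℝ) : ℂ) * omegaPow 2‖ *
        (exp ‖(⟨P, Q⟩ : ℂ)‖ + 2 * exp (-(‖(⟨P, Q⟩ : ℂ)‖ / 2))) ≤
      (exp ‖(⟨P, Q⟩ : ℂ)‖ - exp (-(‖(⟨P, Q⟩ : ℂ)‖ / 2))) *
        (exp P + exp (P * cos (2 * π / 3) - Q * sin (2 * π / 3)) + exp (P * cos (4 * π / 3) - Q * sin (4 * π / 3))) := by
  set z : ℂ := ⟨P, Q⟩ with hz
  set A : ℝ := ‖z‖ with hA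
  set Φ : ℝ := Complex.arg z with hΦ
  have hA0 : 0 ≤ A := norm_nonneg _
  have hP : P = A * cos Φ := by rw [hA, hΦ, Complex.norm_mul_cos_arg]
  have hQ : Q = A * sin Φ := by rw [hA, hΦ, Complex.norm_mul_sin_arg]
  -- the three exponents are A cos(Φ + θ_d)
  have g0 : P = A * cos Φ := hP
  have g1 : P * cos (2 * π / 3) - Q * sin (2 * π / 3) = A * cos (Φ + 2 * π / 3) := by rw [hP, hQ, cos_add]; ring
  have g2 : P * cos (4 * π / 3) - Q * sin (4 * π / 3) = A * cos (Φ + 4 * π / 3) := by rw [hP, hQ, cos_add]; ring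
  rw [g1, g2, g0]
  -- squared form
  have hsum : exp (A * cos Φ) + exp (A * cos (Φ + 2 * π / 3)) + exp (A * cos (Φ + 4 * π / 3)) = clockSum A Φ := rfl
  have hnorm : ‖((exp (A * cos Φ) : ℝ) : ℂ) * omegaPow 0 + ((exp (A * cos (Φ + 2 * π / 3)) : ℝ) : ℂ) * omegaPow 1 +
      ((exp (A * cos (Φ + 4 * π / 3)) : ℝ) : ℂ) * omegaPow 2‖ ^ 2 = clockSum A Φ ^ 2 - 3 * clockSum A (Φ + π / 3) := by
    rw [norm_sq_fourier_three, clockSum_add_pi_div_three, clockSum]; ring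
  have hsq := transmission_sq_le hA0 Φ
  rw [← hnorm, clockSum_zero] at hsq
  rw [hsum]
  have hnn : 0 ≤ exp A - exp (-(A / 2)) := by
    have := exp_le_exp.2 (show -(A / 2) ≤ A by linarith)
    linarith
  have h1 : 0 ≤ ‖((exp (A * cos Φ) : ℝ) : ℂ) * omegaPow 0 + ((exp (A * cos (Φ + 2 * π / 3)) : ℝ) : ℂ) * omegaPow 1 +
      ((exp (A * cos (Φ + 4 * π / 3)) : ℝ) : ℂ) * omegaPow 2‖ * (exp A + 2 * exp (-(A / 2))) := by positivity
  have h2 : 0 ≤ (exp A - exp (-(A / 2))) * clockSum A Φ := mul_nonneg hnn (clockSum_pos A Φ).le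
  nlinarith [h1, h2, hsq]

/-! ### The model on two vertices -/

/-- Summing a function of `k 0 − k 1` over `k : Fin 2 → ℤ₃` counts every difference three times. [folklore] -/
theorem sum_fin_two_sub {M : Type*} [AddCommMonoid M] (F : ZMod 3 → M) :
    ∑ k : Fin 2 → ZMod 3, F (k 0 - k 1) = 3 • ∑ d, F d := by
  rw [← (piFinTwoEquiv fun _ => ZMod 3).symm.sum_comp, Fintype.sum_prod_type]
  simp only [piFinTwoEquiv_symm_apply, Fin.cons_zero, Fin.cons_one]
  have h : ∀ x : ZMod 3, ∑ y : ZMod 3, F (x - y) = ∑ d, F d := fun x => (Equiv.subLeft x).sum_comp F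
  simp only [h, Finset.sum_const, Finset.card_univ, ZMod.card]

/-- The edge profile of the two-vertex model: the `θ`-dependent part of the exponent as a function of `d = k₀ − k₁`. [folklore] -/
def edgeProfile (a φ : Fin 2 → Fin 2 → ℝ) (d : ZMod 3) : ℝ :=
  a 0 1 * cos (2 * π * (d.val : ℝ) / 3 + φ 0 1) + a 1 0 * cos (2 * π * ((-d).val : ℝ) / 3 + φ 1 0)

/-- The two-vertex weight factorises as (a constant from the diagonal entries) × `exp(edgeProfile(k₀ − k₁))`. [folklore] -/
theorem chiralClockWeight_two (a φ : Fin 2 → Fin 2 → ℝ) (k : Fin 2 → ZMod 3) :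
    chiralClockWeight a φ k = exp (a 0 0 * cos (φ 0 0) + a 1 1 * cos (φ 1 1)) * exp (edgeProfile a φ (k 0 - k 1)) := by
  rw [chiralClockWeight, ← exp_add, edgeProfile, Fin.sum_univ_two, Fin.sum_univ_two, Fin.sum_univ_two]
  have h1 : k 1 - k 0 = -(k 0 - k 1) := (neg_sub (k 0) (k 1)).symm
  rw [h1]
  simp only [sub_self, ZMod.val_zero, Nat.cast_zero, mul_zero, zero_div, zero_add]
  ring_nf

/-- The edge profile at `d = 0`. [folklore] -/
theorem edgeProfile_zero (a φ : Fin 2 → Fin 2 → ℝ) : edgeProfile a φ 0 = a 0 1 * cos (φ 0 1) + a 1 0 * cos (φ 1 0) := by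
  simp [edgeProfile]

/-- The edge profile at `d = 1` in first-harmonic form `P cos(2π/3) − Q sin(2π/3)`, `P + iQ = a₀₁e^{iφ₀₁} + a₁₀e^{−iφ₁₀}`. [folklore] -/
theorem edgeProfile_one (a φ : Fin 2 → Fin 2 → ℝ) :
    edgeProfile a φ 1 = (a 0 1 * cos (φ 0 1) + a 1 0 * cos (φ 1 0)) * cos (2 * π / 3) -
      (a 0 1 * sin (φ 0 1) - a 1 0 * sin (φ 1 0)) * sin (2 * π / 3) := by
  have hv1 : (1 : ZMod 3).val = 1 := by decide
  have hv2 : (-1 : ZMod 3).val = 2 := by decide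
  rw [edgeProfile, hv1, hv2]
  push_cast
  have e1 : 2 * π * 1 / 3 + φ 0 1 = 2 * π / 3 + φ 0 1 := by ring
  have e2 : 2 * π * 2 / 3 + φ 1 0 = 4 * π / 3 + φ 1 0 := by ring
  rw [e1, e2, cos_add, cos_add, cos_four_pi_div_three, sin_four_pi_div_three, cos_two_pi_div_three, sin_two_pi_div_three]
  ring

/-- The edge profile at `d = 2` in first-harmonic form `P cos(4π/3) − Q sin(4π/3)`. [folklore] -/
theorem edgeProfile_two (a φ : Fin 2 → Fin 2 → ℝ) :
    edgeProfile a φ 2 = (a 0 1 * cos (φ 0 1) + a 1 0 * cos (φ 1 0)) * cos (4 * π / 3) -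
      (a 0 1 * sin (φ 0 1) - a 1 0 * sin (φ 1 0)) * sin (4 * π / 3) := by
  have hv1 : (2 : ZMod 3).val = 2 := by decide
  have hv2 : (-2 : ZMod 3).val = 1 := by decide
  rw [edgeProfile, hv1, hv2]
  push_cast
  have e1 : 2 * π * 2 / 3 + φ 0 1 = 4 * π / 3 + φ 0 1 := by ring
  have e2 : 2 * π * 1 / 3 + φ 1 0 = 2 * π / 3 + φ 1 0 := by ring
  rw [e1, e2, cos_add, cos_add, cos_four_pi_div_three, sin_four_pi_div_three, cos_two_pi_div_three, sin_two_pi_div_three]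
  ring

/-- The numerator/denominator sums of the two-vertex model reduce to three-term sums over `d = k₀ − k₁`. [folklore] -/
theorem sum_weight_two (a φ : Fin 2 → Fin 2 → ℝ) (h : ZMod 3 → ℂ) :
    ∑ k : Fin 2 → ZMod 3, (chiralClockWeight a φ k : ℂ) * h (k 0 - k 1) =
      3 * (exp (a 0 0 * cos (φ 0 0) + a 1 1 * cos (φ 1 1)) : ℂ) *
        ((exp (edgeProfile a φ 0) : ℂ) * h 0 + (exp (edgeProfile a φ 1) : ℂ) * h 1 + (exp (edgeProfile a φ 2) : ℂ) * h 2) := by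
  have key := sum_fin_two_sub (M := ℂ)
    (fun d => ((exp (a 0 0 * cos (φ 0 0) + a 1 1 * cos (φ 1 1)) * exp (edgeProfile a φ d) : ℝ) : ℂ) * h d)
  simp_rw [chiralClockWeight_two]
  rw [key, sum_zmod_three, nsmul_eq_mul]
  push_cast
  ring

/-- The partition function of the chiral clock model is non-zero (a sum of positive reals). [folklore] -/
theorem sum_chiralClockWeight_ne_zero {n : ℕ} (a φ : Fin n → Fin n → ℝ) :
    ∑ k : Fin n → ZMod 3, (chiralClockWeight a φ k : ℂ) ≠ 0 := by
  rw [← Complex.ofReal_sum]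
  have : 0 < ∑ k : Fin n → ZMod 3, chiralClockWeight a φ k :=
    Finset.sum_pos (fun k _ => by unfold chiralClockWeight; exact exp_pos _) Finset.univ_nonempty
  exact_mod_cast this.ne'

/-- The diagonal two-point function is `1`. [folklore] -/
theorem chiralClockCorr_self {n : ℕ} (a φ : Fin n → Fin n → ℝ) (b : Fin n) : chiralClockCorr a φ b b = 1 := by
  unfold chiralClockCorr
  simp only [sub_self, omegaPow_zero, mul_one]
  exact div_self (sum_chiralClockWeight_ne_zero a φ)

/-- **(C) ON TWO VERTICES, OFF-DIAGONAL PAIRS.**  For `a ≥ 0` entrywise on `Fin 2` and every `φ`: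
`‖⟨ω^{k₀−k₁}⟩_{a,φ}‖ ≤ Re ⟨ω^{k₀−k₁}⟩_{a,0}` and the same for the pair `(1, 0)`.  The two oriented entries `a 0 1`, `a 1 0` combine into
ONE chiral edge of coupling `A = |a₀₁e^{iφ₀₁} + a₁₀e^{−iφ₁₀}| ≤ a₀₁ + a₁₀` (the ferromagnet's coupling); then (C1) (`transmission_le`) and the
monotonicity of the ferromagnetic transmission (`transmission_mono`). [folklore] -/
theorem chiralClockComparison_two_offDiag (a φ : Fin 2 → Fin 2 → ℝ) (ha01 : 0 ≤ a 0 1) (ha10 : 0 ≤ a 1 0) :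
    ‖chiralClockCorr a φ 0 1‖ ≤ (chiralClockCorr a (fun _ _ => 0) 0 1).re ∧
      ‖chiralClockCorr a φ 1 0‖ ≤ (chiralClockCorr a (fun _ _ => 0) 1 0).re := by
  -- notation
  set P : ℝ := a 0 1 * cos (φ 0 1) + a 1 0 * cos (φ 1 0) with hP
  set Q : ℝ := a 0 1 * sin (φ 0 1) - a 1 0 * sin (φ 1 0) with hQ
  set B : ℝ := a 0 1 + a 1 0 with hB
  have hB0 : 0 ≤ B := add_nonneg ha01 ha10
  -- the three chiral weights and the three ferromagnetic weights
  set x0 : ℝ := exp P with hx0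
  set x1 : ℝ := exp (P * cos (2 * π / 3) - Q * sin (2 * π / 3)) with hx1
  set x2 : ℝ := exp (P * cos (4 * π / 3) - Q * sin (4 * π / 3)) with hx2
  have hg0 : edgeProfile a φ 0 = P := edgeProfile_zero a φ
  have hg1 : edgeProfile a φ 1 = P * cos (2 * π / 3) - Q * sin (2 * π / 3) := edgeProfile_one a φ
  have hg2 : edgeProfile a φ 2 = P * cos (4 * π / 3) - Q * sin (4 * π / 3) := edgeProfile_two a φ
  have hf0 : edgeProfile a (fun _ _ => 0) 0 = B := by rw [edgeProfile_zero]; simp [hB]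
  have hf1 : edgeProfile a (fun _ _ => 0) 1 = -(B / 2) := by
    rw [edgeProfile_one]; simp [hB, cos_two_pi_div_three]; ring
  have hf2 : edgeProfile a (fun _ _ => 0) 2 = -(B / 2) := by
    rw [edgeProfile_two]; simp [hB, cos_four_pi_div_three]; ring
  have hS : 0 < x0 + x1 + x2 := by positivity
  -- |P + iQ| ≤ B
  have hPQ : P ^ 2 + Q ^ 2 = a 0 1 ^ 2 + a 1 0 ^ 2 + 2 * a 0 1 * a 1 0 * cos (φ 0 1 + φ 1 0) := by
    rw [hP, hQ, cos_add]
    linear_combination (a 0 1) ^ 2 * sin_sq_add_cos_sq (φ 0 1) + (a 1 0) ^ 2 * sin_sq_add_cos_sq (φ 1 0)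
  have hAB : ∀ s : ℝ, s = 1 ∨ s = -1 → ‖(⟨P, s * Q⟩ : ℂ)‖ ≤ B := by
    intro s hs
    have hs2 : s ^ 2 = 1 := by rcases hs with rfl | rfl <;> norm_num
    have h2 : ‖(⟨P, s * Q⟩ : ℂ)‖ ^ 2 ≤ B ^ 2 := by
      rw [Complex.sq_norm, Complex.normSq_mk]
      have hc := cos_le_one (φ 0 1 + φ 1 0)
      have hab : 0 ≤ a 0 1 * a 1 0 := mul_nonneg ha01 ha10
      nlinarith [hPQ, hs2, hc, hab]
    exact (pow_le_pow_iff_left₀ (norm_nonneg _) hB0 two_ne_zero).1 h2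
  -- the ferromagnetic side, as a real number
  have hferro : ∀ h : ZMod 3 → ℂ, h 0 = 1 → h 1 + h 2 = -1 →
      (∑ k : Fin 2 → ZMod 3, (chiralClockWeight a (fun _ _ => 0) k : ℂ) * h (k 0 - k 1)) /
        (∑ k : Fin 2 → ZMod 3, (chiralClockWeight a (fun _ _ => 0) k : ℂ)) =
        (((exp B - exp (-(B / 2))) / (exp B + 2 * exp (-(B / 2))) : ℝ) : ℂ) := by
    intro h h0 h12
    have hD := sum_weight_two a (fun _ _ => 0) (fun _ => 1)
    simp only [mul_one] at hD
    rw [sum_weight_two, hD, hf0, hf1, hf2, mul_div_mul_left]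
    · have h2' : h 2 = -1 - h 1 := by rw [← h12]; ring
      rw [h0, h2']
      push_cast
      have hne : (exp B : ℂ) + 2 * exp (-(B / 2)) ≠ 0 := by
        have : (0 : ℝ) < exp B + 2 * exp (-(B / 2)) := by positivity
        exact_mod_cast this.ne'
      field_simp
      ring
    · have : (0 : ℝ) < 3 * exp (a 0 0 * cos 0 + a 1 1 * cos 0) := by positivity
      exact_mod_cast this.ne'
  -- the chiral side
  have hchiral : ∀ h : ZMod 3 → ℂ,
      (∑ k : Fin 2 → ZMod 3, (chiralClockWeight a φ k : ℂ) * h (k 0 - k 1)) /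
        (∑ k : Fin 2 → ZMod 3, (chiralClockWeight a φ k : ℂ)) =
        ((x0 : ℂ) * h 0 + (x1 : ℂ) * h 1 + (x2 : ℂ) * h 2) / ((x0 + x1 + x2 : ℝ) : ℂ) := by
    intro h
    have hD := sum_weight_two a φ (fun _ => 1)
    simp only [mul_one] at hD
    rw [sum_weight_two, hD, hg0, hg1, hg2, mul_div_mul_left, ← hx0, ← hx1, ← hx2, Complex.ofReal_add, Complex.ofReal_add]
    · have : (0 : ℝ) < 3 * exp (a 0 0 * cos (φ 0 0) + a 1 1 * cos (φ 1 1)) := by positivity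
      exact_mod_cast this.ne'
  -- transmission bounds for (P, Q) and (P, -Q)
  have hr : ∀ N : ℂ, ∀ s : ℝ, s = 1 ∨ s = -1 →
      ‖N‖ * (exp ‖(⟨P, s * Q⟩ : ℂ)‖ + 2 * exp (-(‖(⟨P, s * Q⟩ : ℂ)‖ / 2))) ≤
        (exp ‖(⟨P, s * Q⟩ : ℂ)‖ - exp (-(‖(⟨P, s * Q⟩ : ℂ)‖ / 2))) * (x0 + x1 + x2) →
      ‖N / ((x0 + x1 + x2 : ℝ) : ℂ)‖ ≤ (exp B - exp (-(B / 2))) / (exp B + 2 * exp (-(B / 2))) := by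
    intro N s hs hN
    set A := ‖(⟨P, s * Q⟩ : ℂ)‖ with hA
    have hmono := transmission_mono (hAB s hs)
    rw [norm_div, Complex.norm_real, Real.norm_eq_abs, abs_of_pos hS, div_le_div_iff₀ hS (by positivity)]
    have hEA : 0 < exp A + 2 * exp (-(A / 2)) := by positivity
    have hEB : 0 < exp B + 2 * exp (-(B / 2)) := by positivity
    refine le_of_mul_le_mul_right ?_ hEA
    calc ‖N‖ * (exp B + 2 * exp (-(B / 2))) * (exp A + 2 * exp (-(A / 2)))
        = ‖N‖ * (exp A + 2 * exp (-(A / 2))) * (exp B + 2 * exp (-(B / 2))) := by ring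
      _ ≤ (exp A - exp (-(A / 2))) * (x0 + x1 + x2) * (exp B + 2 * exp (-(B / 2))) :=
          mul_le_mul_of_nonneg_right hN hEB.le
      _ = (exp A - exp (-(A / 2))) * (exp B + 2 * exp (-(B / 2))) * (x0 + x1 + x2) := by ring
      _ ≤ (exp B - exp (-(B / 2))) * (exp A + 2 * exp (-(A / 2))) * (x0 + x1 + x2) :=
          mul_le_mul_of_nonneg_right hmono hS.le
      _ = (exp B - exp (-(B / 2))) * (x0 + x1 + x2) * (exp A + 2 * exp (-(A / 2))) := by ring
  refine ⟨?_, ?_⟩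
  · -- the pair (0, 1): h = omegaPow
    unfold chiralClockCorr
    rw [hferro omegaPow omegaPow_zero (by rw [omegaPow_one, omegaPow_two]; apply Complex.ext <;> simp),
      Complex.ofReal_re, hchiral omegaPow]
    refine hr _ 1 (Or.inl rfl) ?_
    have := transmission_le P Q
    simp only [one_mul]
    rw [hx0, hx1, hx2]
    exact this
  · -- the pair (1, 0): h = omegaPow ∘ neg
    unfold chiralClockCorr
    have hneg : ∀ (ψ : Fin 2 → Fin 2 → ℝ) (k : Fin 2 → ZMod 3),
        (chiralClockWeight a ψ k : ℂ) * omegaPow (k 1 - k 0) = (chiralClockWeight a ψ k : ℂ) * (fun d => omegaPow (-d)) (k 0 - k 1) := by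
      intro ψ k; simp only [neg_sub]
    simp_rw [hneg]
    have hm1 : (-1 : ZMod 3) = 2 := by decide
    have hm2 : (-2 : ZMod 3) = 1 := by decide
    rw [hferro (fun d => omegaPow (-d)) (by rw [neg_zero, omegaPow_zero])
      (by rw [hm1, hm2, omegaPow_one, omegaPow_two]; apply Complex.ext <;> simp), Complex.ofReal_re,
      hchiral (fun d => omegaPow (-d))]
    simp only [neg_zero, hm1, hm2]
    refine hr _ (-1) (Or.inr rfl) ?_
    have := transmission_le P (-Q)
    have e1 : P * cos (2 * π / 3) - -Q * sin (2 * π / 3) = P * cos (4 * π / 3) - Q * sin (4 * π / 3) := by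
      rw [cos_two_pi_div_three, cos_four_pi_div_three, sin_two_pi_div_three, sin_four_pi_div_three]; ring
    have e2 : P * cos (4 * π / 3) - -Q * sin (4 * π / 3) = P * cos (2 * π / 3) - Q * sin (2 * π / 3) := by
      rw [cos_two_pi_div_three, cos_four_pi_div_three, sin_two_pi_div_three, sin_four_pi_div_three]; ring
    rw [e1, e2, ← hx0, ← hx1, ← hx2] at this
    have e3 : (x0 : ℂ) * omegaPow 0 + (x1 : ℂ) * omegaPow 2 + (x2 : ℂ) * omegaPow 1 =
        (x0 : ℂ) * omegaPow 0 + (x2 : ℂ) * omegaPow 1 + (x1 : ℂ) * omegaPow 2 := by ring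
    have e4 : x0 + x2 + x1 = x0 + x1 + x2 := by ring
    rw [e3, neg_one_mul]
    rw [e4] at this
    exact this

/-- **CONJECTURE (C) HOLDS ON TWO VERTICES** (one chiral edge, both orientations allowed, arbitrary diagonal entries):
for `a ≥ 0` entrywise, all `φ` and all `b, t : Fin 2`, `‖⟨ω^{k_b−k_t}⟩_{a,φ}‖ ≤ Re ⟨ω^{k_b−k_t}⟩_{a,0}`. [folklore] -/
theorem chiralClockComparison_two (a φ : Fin 2 → Fin 2 → ℝ) (ha : ∀ x y, 0 ≤ a x y) (b t : Fin 2) :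
    ‖chiralClockCorr a φ b t‖ ≤ (chiralClockCorr a (fun _ _ => 0) b t).re := by
  have hoff := chiralClockComparison_two_offDiag a φ (ha 0 1) (ha 1 0)
  fin_cases b <;> fin_cases t
  · simp [chiralClockCorr_self]
  · exact hoff.1
  · exact hoff.2
  · simp [chiralClockCorr_self]

/-- **THE TYPED CONJECTURE `ChiralClockComparison` RESTRICTED TO `n ≤ 2` VERTICES IS A THEOREM** (`n = 0`: vacuous; `n = 1`: the diagonal
two-point function is `1`; `n = 2`: `chiralClockComparison_two`).  What remains open is `n ≥ 3`, i.e. graphs with a cycle or a path of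
length `≥ 2` (on trees the two-point function factorises over the path, edge by edge — not formalised here). [folklore] -/
theorem chiralClockComparison_of_le_two :
    ∀ n ≤ 2, ∀ (a φ : Fin n → Fin n → ℝ), (∀ x y, 0 ≤ a x y) → ∀ b t : Fin n,
      ‖chiralClockCorr a φ b t‖ ≤ (chiralClockCorr a (fun _ _ => 0) b t).re := by
  intro n hn a φ ha b t
  rcases n with _ | _ | _ | n
  · exact b.elim0
  · have hbt : t = b := Fin.ext (by have := t.isLt; have := b.isLt; omega)
    subst hbt
    simp [chiralClockCorr_self]
  · exact chiralClockComparison_two a φ ha b t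
  · omega

end Summit.Ventures.YMGap.Conjectures

end
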